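import Literature.MathematicalPhysics.QuantumFieldTheory.Balaban1983to89.B9Eq3105FamThreeMember
import Literature.MathematicalPhysics.QuantumFieldTheory.Balaban1983to89.B9Cor36GpCubeLocAtMember

/-!
# `Balaban1983to89.B9Eq3105FamThreeAtLocCfg` — FAMILY 3 OF (3.105) AT THE LOCATED LETTERS OF RECORD: the consumer's `hrest` summand
# `Σ_□ conj b((M_{ζ_□̃}·(DPD*(U₁) − Pl_□)·(M_{h_□}·O_□·M_{h_□}))^ℝ)` with `Pl_□ = R(u_□)⁻¹·DP_□D*(Ṽ_□)·R(u_□)` (G-F2's transported cube projection), the ζ of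
# record `zetaY`, and the (3.35) window `U₁^{u_□} = Ṽ_□` near □ — ASSEMBLED from F3-C (cover), F3-B (the member words) and the window geometry, so that
# family 3 is CLOSED AT THE LETTERS modulo exactly: the located `G′`-difference entries `hDL`∕`hDR` (memo D1), the (3.49)₄ entry of the located
# `C`-difference word `hP3` (memo D2, typed), and the letters' blocks `hE`∕`hEO`∕`hCinv` (sub-row G-B9-LETTERS, GAPS G-B9-05∕family 3, programme FAMTHREE
# FILE F3-P; lead g34 RULING FAMTHREE-2 2026-08-29)

statement-level skeleton of published theorems with citation tags; proofs where landed; nothing here is a claim about the Yang–Mills mass gap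

THE PRINTED LOCUS (verbatim, held `paper:balaban1985-cmp99-background-propagators`, journal page = PDF page + 388).  p. 414 (3.105), third sum:
«− Σ_□ ζ_□̃(DPD* − DP_□D*)h_□G_□h_□ … where the function ζ_□̃ is defined similarly to h_□, i.e. ζ_□̃ ∈ C₀^∞(□̃) and ζ_□̃ = 1 on a cube containing □»; p. 415
l.29–37: «Next we replace the operators G′_{□₀} and C_{□₀} by G′_□, C_□, terms with the differences G′_{□₀} − G′_□ and C_{□₀} − C_□ are small by the same reason
as before. … This expression cancels the second term in the third sum.»; Cor. 3.6 p. 408 («U′ = U^u = e^{iηA}» on `Ω(□)`); (3.33)–(3.34) p. 396; (3.49) p. 399;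
p. 412 l.22–36; p. 399 l.19–24; (3.87) p. 409; [4] (2.51)–(2.55) p. 232, Lemma 2.1 (2.61) p. 234; [2] = `Balaban1983RegularityDecay`, (1.11)–(1.12).

WHY THIS FILE.  F3-C reduced the `hrest` family-3 summand to a per-cube binder `hX □`; F3-B (`B9Eq3105FamThreeMember.hasMajorant_famThree_located_zetaY_of_cDiff`)
supplies `hX □` for `Pl □ := DPDsCubeY i □ parS V′_□` under the window `V′_□ = U₁` on the bonds issued from `supp ζ_□̃♭ ∪ supp h_□♭`, modulo `hDL`∕`hDR`
and the located `C`-difference word.  THIS FILE puts the consumer's letters in: `V′_□ := Ṽ_□^{u_□⁻¹}` (so `Pl □ = locProjBY i □ parS u_□ Ṽ_□`, F3-A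
`locProjBY_eq_DPDsCubeY`), the window DISCHARGED from the (3.35) agreement `U₁^{u_□} = Ṽ_□` within `2S_j` of the centre of `β` (G-F6a's
`UboxY_gaugeY_eq_locCfgY` shape: `□̃ ⊂ NearC 2S_j`, `supp h_□ ⊂ NearC S_j`), and the `C`-difference word displayed in print's (3.49)₄ dress
(`hP3`: the fourth (3.49) entry of `M_χ·G′_□(S − S_□)G′_□·M_χ`) rather than with the outer cut-offs.

WHAT THIS FILE CERTIFIES (kernel-checked; 0 `def`, 0 `def … : Prop`, 0 sorry; standard axioms only)

* §1 `gaugeY_inv_apply_of_eq` (pointwise: `V(b) = U^g(b) ⟹ V^{g⁻¹}(b) = U(b)`), ★ `window_of_UboxY_agree` (the bond window for ANY profile whose support charts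
  within `r` of the centre, from the site agreement `UboxY (U^g) = UboxY V` on `NearC r`), its instances `window_zetaY`, `window_hTY`.
* §2 `located_word_eq₁` (both plateau insertions on ONE word), ★★ `hasMajorant_cDiffWord_located_of_entry` (`hP3 ⟹ hT3`: the (3.49)₄ entry of the located
  `C`-difference word gives F3-B's cut-off form, `|ζ♭|, |h♭| ≤ 1`).
* §3 ★★★ `hasMajorant_sum_famThree_at_locLetters` — THE `hrest` FAMILY-3 SUMMAND AT THE LETTERS: for a gauge-law `parS`, gauges `u_□`, fields `Ṽ_□` agreeing
  with `U₁^{u_□}` on `NearC 2S_j` (site form), any per-cube plateau cut-offs `χ_□` (`= 1` on the gradient stencils of `supp ζ_□̃♭ ∪ supp h_□♭`), the ζ of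
  record and `Pl □ = locProjBY i □ parS (u □) (Ṽ □)`:
  `Σ_□ conj b((M_{ζ_□̃}·(DPDsY parS G′ U₁ − Pl □)·(M_{h_□}·Oc □ U₁·M_{h_□}))^ℝ) ≺ 3·5^{d+1}·((κ_F3(ε_D) + ε₃)·(M₂Σ‖b_j‖B₀)·Λ′·c₁(δ,1−ρ′))·e^{−ρ′δ·d}` over
  `(toB6 (geo9K i) Rr Hp, ιB∘blkV1)`, modulo: `hDL □`∕`hDR □` (located `G′`-difference entries at `χ_□`, constant `ε_D`), `hP3 □` (the located `C`-difference word's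
  (3.49)₄ entry, constant `ε₃`), `hE` ((3.42) of `G′(U₁)`), `hEO` (the `O_□`), `hCinv` ((3.48)), bi-contractive `parS`, `η = |c_f|⁻¹`, the member (2.61) ∕ transfers;
  ★★ `hasMajorant_sum_famThree_at_locCfg` — the same at `Ṽ_□ := locCfgY i □ η (A □)`, `parS := parSymY i`, `χ_□ := chiY i □`, the plateau hypotheses and the
  site agreement DISCHARGED (`B9Eq3105FamThreeCore` §2; the (3.35) datum's `hQ`∕`hgA`, G-F6a `UboxY_gaugeY_eq_locCfgY`).

HONEST SCOPE ∕ NOT CLAIMED.  Family 3 of (3.105) (the `hrest` side) is hereby CLOSED AT THE LETTERS MODULO: (D1) the located `G′`-difference entries `hDL`∕`hDR`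
and (D2) the (3.49)₄ entry `hP3` of the located `C`-difference word `M_χ·G′_□(V′)·(Q′*X⁻¹Q′(U₁) − Q′*_□X_□⁻¹Q′_□(V′))·G′_□(V′)·M_χ` — both `hD`-species inputs
with explicit constants and supplier NONE (GAPS G-B9-05; print: «small by the same reason as before», p. 415, = O(e^{−2δ₀M}) by [2] (1.11)–(1.12), p. 412
l.22–36; in the (R)-design the member and cube `C`-letters live on different coarse lattices, so the `C`-difference exists only inside the site word — D2's typed
form); plus the letters' blocks `hE`, `hEO`, `hCinv`, bi-contractivity, `η = |c_f|⁻¹`, the member (2.61) ∕ transfers, exactly as Z2-P ∕ F3-C display them.  NOT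
here: the transposed `hV′` family-3 word (F3-D), the knit into `hrest`, `hsmall`.  Count-neutral; NOT a node discharge; no summit ∕ sub-problem statement is
proved; nothing continuum ∕ OS ∕ mass-gap ∕ Clay; YM mass gap NOT proved (Track A conditional rung).  No `sorry`, no `axiom`, no `… : Prop` fact, no `instance`,
no `notation`, no `def`.  NEW file; nothing landed is modified.  Cell `lit-balaban`, seat `lit-balaban-p33` gen 103, 2026-08-29; `--supports
stmt-QuantumFields-19200` as helper.  Net new unproved facts: 0.

RELATED IN THE TREE, NOT DUPLICATED (searched 2026-08-29: `rg 'famThree_at_loc|window_zetaY' Literature/` = ∅): F3-A∕B∕C (`B9Eq3105FamThreeLetters`∕`Core`∕`Member`∕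
`Cover`), G-F6a `B9Cor36GpCubeLocAtMember.UboxY_gaugeY_eq_locCfgY`, G-F2 `B9Cor36GCubeLocLetter` (`locProjBY`), p21 `B9ThmDCubePlateau.nearC_of_mem_QbigT`, p33
`B9Cor36CubeCutoffs`, `B9Eq3105ZetaY`, def-Y `Node00.parSymY_isGaugeLawS` — all USED BY NAME.
-/

noncomputable section

namespace Literature.MathematicalPhysics.QuantumFieldTheory.Balaban1983to89.B9Eq3105FamThreeAtLocCfg

open NormedSpace Complex
open B6RandomWalk (HasMajorant hasMajorant_mono hasMajorant_add Ineq261 c1_nonneg Triangle254)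
open B9FromB6 (EBlock)
open B9Thm34Ext (toB6)
open B9Thm37Sum (mulOp mulOp_apply)
open B9Ineq347 (ScaleTransfer)
open B9Eq352DivFormLetters (conj)
open B9Eq352GradLetters (diffLetter)
open B6KLevelCensusIndexV1 (KIdx kGeo)
open B6Cover236MultiLevelBlocks (cubes)
open B6GlobalChartV1 (blkV1 PV boxEquiv)
open B6Geom246MultiLevelBox (blkOf)
open B6Ineq2142KLevelV1 (β)
open B9GeoNormsKLevelV1 (geo9K)
open B9GeoLemma21KLevelV1 (one_le_Mh)
open B9Eq39Adjoint (fluct)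
open B9Eq360DeltaPrimeAY (AfldY)
open B9Thm37CubeCoverCommutators (cutMulY cutMulY_apply hTY)
open B9Thm39CinvTorusRegular (conj_cutMulY)
open B9Eq395Small (hasMajorant_mulOp_left hasMajorant_mul_mulOp_right)
open B9Eq3104CutoffCommutators (hBdY hBdY_apply DPDsY)
open B9Eq3105AtLetters (DPDsCubeY)
open B9Eq3105ZetaY (zetaY mem_of_zetaY_ne_zero abs_hBdY_zetaY_le_one)
open B9Eq3105FamThreeLetters (locProjBY_eq_DPDsCubeY)
open B9Eq3105FamThreeCore (cutMulY_comp_gradY_eq_of_plateau divY_comp_cutMulY_eq_of_plateau chiY_eq_one_of_zetaY_gradK chiY_eq_one_of_hTY_gradK)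
open B9Eq3105FamThreeMember (hasMajorant_famThree_located_of_cDiff)
open B9Eq3105FamThreeCover (hasMajorant_sum_famThree_zetaY_of_eBlock)
open B9CubeLettersOpsL0 (GpCubeY)
open B9CubeLettersBondOpsL0 (QpCubeY QpsCubeY XinvCubeY)
open B9CubeLettersInvReadings (kernelFamilySInv kernelFamilyBInv)
open B9Cor36CubeCutoffs (SC NearC locCfgY one_le_SC nine_le_SC nearC_of_hT_ne_zero)
open B9Cor36GCubeLocLetter (locProjBY)
open B9Cor36GpCubeLocAtMember (UboxY_gaugeY_eq_locCfgY)
open B9ThmDCubePlateau (nearC_of_mem_QbigT)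
open Node00 (SiteY BlkY IBondY FBondY CfgY GaugeY SiteOpY BondOpY SiteParY BondParY toKT etaS shiftY UboxY QpY QpsY XinvY gradY divY gradK
  gaugeY gaugeY_apply parSymY parSymY_isGaugeLawS IsGaugeLawS)
open Node00.OpsYNablaBridge (chartY)

variable {d ℓ : ℕ} {hd : 1 ≤ d + 1} {hL : Odd (ℓ + 1) ∧ 1 < ℓ + 1} {b₀ b₁ : ℝ}
variable {𝔸 : Type} [NormedRing 𝔸] [NormedAlgebra ℂ 𝔸] [CompleteSpace 𝔸]
variable {ι : Type} [Fintype ι]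
variable (i : KIdx d ℓ hd hL b₀ b₁) (c : ↥(cubes i.D.toDomains)) (b : Module.Basis ι ℝ 𝔸)

/-! ## §1  The (3.35) window on the bonds issued from `supp ζ_□̃`, `supp h_□` -/

section Window

/-- pointwise gauge inversion on one bond: `V_μ(x) = (U^g)_μ(x) ⟹ (V^{g⁻¹})_μ(x) = U_μ(x)` ((3.28)). [cite: Balaban1985BackgroundPropagators, (3.28) p.395, bookkeeping] -/
theorem gaugeY_inv_apply_of_eq (g : GaugeY 𝔸 i) (U V : CfgY 𝔸 i) (μ : Fin (d + 1)) (x : Site (PV d ℓ i.m i.K hd hL) 0)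
    (h : V μ x = gaugeY i g U μ x) : gaugeY i g⁻¹ V μ x = U μ x := by
  rw [gaugeY_apply, h, gaugeY_apply]
  simp only [Pi.inv_apply, inv_inv]
  group

/-- ★ **THE BOND WINDOW FROM THE SITE AGREEMENT**: if `UboxY (U^g) κ w = UboxY V κ w` for every `w` within `r` of the centre of `β` and every bond of `supp f♭`
starts within `r`, then `V^{g⁻¹} = U` on the bonds issued from `supp f♭` (F3-A∕F3-B's window hypothesis shape).
[cite: Balaban1985BackgroundPropagators, Cor. 3.6 p.408 («U′ = U^u = e^{iηA}»), (3.28) p.395] -/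
theorem window_of_UboxY_agree (g : GaugeY 𝔸 i) (U V : CfgY 𝔸 i) {r : ℤ} (f : SiteY i → ℝ)
    (hagree : ∀ w : SiteY i, NearC i c r w.1 → ∀ κ : Fin (d + 1), UboxY i (gaugeY i g U) κ w = UboxY i V κ w)
    (hf : ∀ z : SiteY i, f z ≠ 0 → NearC i c r z.1) (bnd : FBondY i) (hb : hBdY i f bnd ≠ 0) :
    gaugeY i g⁻¹ V bnd.dir bnd.src = U bnd.dir bnd.src := by
  refine gaugeY_inv_apply_of_eq i g U V bnd.dir bnd.src ?_
  have h := hagree (chartY i bnd.src) (hf _ hb) bnd.dir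
  change gaugeY i g U bnd.dir ((boxEquiv i.hN).symm (boxEquiv i.hN bnd.src)) = V bnd.dir ((boxEquiv i.hN).symm (boxEquiv i.hN bnd.src)) at h
  rw [Equiv.symm_apply_apply] at h
  exact h.symm

/-- ★ the window for `ζ_□̃ = zetaY` (`□̃ ⊂ NearC 2S_j`). [cite: Balaban1985BackgroundPropagators, (3.105) p.414, Cor. 3.6 p.408; Balaban1984PropagatorsII, p.239] -/
theorem window_zetaY (g : GaugeY 𝔸 i) (U V : CfgY 𝔸 i)
    (hagree : ∀ w : SiteY i, NearC i c (2 * SC i c) w.1 → ∀ κ : Fin (d + 1), UboxY i (gaugeY i g U) κ w = UboxY i V κ w)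
    (bnd : FBondY i) (hb : hBdY i (zetaY i c) bnd ≠ 0) : gaugeY i g⁻¹ V bnd.dir bnd.src = U bnd.dir bnd.src :=
  window_of_UboxY_agree i c g U V (zetaY i c) hagree (fun _ hz => nearC_of_mem_QbigT i c (mem_of_zetaY_ne_zero i c hz) rfl) bnd hb

/-- ★ the window for `h_□` (`supp h_□ ⊂ NearC S_j ⊂ NearC 2S_j`). [cite: Balaban1985BackgroundPropagators, (3.87) p.409, Cor. 3.6 p.408; Balaban1984PropagatorsII, (2.36) p.229] -/
theorem window_hTY (g : GaugeY 𝔸 i) (U V : CfgY 𝔸 i)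
    (hagree : ∀ w : SiteY i, NearC i c (2 * SC i c) w.1 → ∀ κ : Fin (d + 1), UboxY i (gaugeY i g U) κ w = UboxY i V κ w)
    (bnd : FBondY i) (hb : hBdY i (hTY i c) bnd ≠ 0) : gaugeY i g⁻¹ V bnd.dir bnd.src = U bnd.dir bnd.src :=
  window_of_UboxY_agree i c g U V (hTY i c) hagree
    (fun _ hz => (nearC_of_hT_ne_zero i c hz).mono i c (by linarith [one_le_SC i c])) bnd hb

/-- ★ **THE SITE AGREEMENT FROM THE (3.35) DATUM** (G-F6a): `hQ`, `hgA` ⟹ `UboxY (U^u) κ w = UboxY Ṽ_□ κ w` within `2S_j` (`2S_j ≤ min(3.75, 4.375)S_j`).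
[cite: Balaban1985BackgroundPropagators, Cor. 3.6 p.408 («U′ = U^u = e^{iηA}»), p.409 l.1–3, p.410 l.14–15] -/
theorem agree_of_datum (g : GaugeY 𝔸 i) (U : CfgY 𝔸 i) (A : AfldY 𝔸 i) (Q : Set (Site (PV d ℓ i.m i.K hd hL) 0)) (η : ℝ)
    (hQ : ∀ x : Site (PV d ℓ i.m i.K hd hL) 0, NearC i c (35 * SC i c / 8 + 1) (boxEquiv i.hN x).1 → x ∈ Q)
    (hgA : ∀ (κ : Fin (d + 1)) (x : Site (PV d ℓ i.m i.K hd hL) 0), x ∈ Q → x.shift κ ∈ Q → gaugeY i g U κ x = fluct η A κ x)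
    (w : SiteY i) (hw : NearC i c (2 * SC i c) w.1) (κ : Fin (d + 1)) :
    UboxY i (gaugeY i g U) κ w = UboxY i (locCfgY i c η A) κ w := by
  have h9 := nine_le_SC i c
  exact UboxY_gaugeY_eq_locCfgY i c η (by omega) (by omega) hQ hgA hw κ

end Window

/-! ## §2  The located `C`-difference word: from its (3.49)₄ entry to F3-B's cut-off form -/

section CDiff

/-- both plateau insertions on ONE word: `M_ζ·D·W·D*·M_h = M_ζ·D·(M_χ·W·M_χ)·D*·M_h`. [cite: Balaban1985BackgroundPropagators, (3.105) p.414, bookkeeping] -/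
theorem located_word_eq₁ {V W : Type} [AddCommGroup V] [Module ℂ V] [AddCommGroup W] [Module ℂ W]
    (Mz Mh : W →ₗ[ℂ] W) (D : V →ₗ[ℂ] W) (Ds : W →ₗ[ℂ] V) (Mx T : V →ₗ[ℂ] V)
    (hzg : Mz ∘ₗ D = Mz ∘ₗ D ∘ₗ Mx) (hdh : Ds ∘ₗ Mh = Mx ∘ₗ Ds ∘ₗ Mh) :
    Mz ∘ₗ (D ∘ₗ T ∘ₗ Ds) ∘ₗ Mh = Mz ∘ₗ (D ∘ₗ (Mx ∘ₗ T ∘ₗ Mx) ∘ₗ Ds) ∘ₗ Mh := by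
  have hzg' : ∀ X : W →ₗ[ℂ] V, Mz ∘ₗ (D ∘ₗ X) = Mz ∘ₗ (D ∘ₗ (Mx ∘ₗ X)) := fun X => by
    rw [← LinearMap.comp_assoc, hzg, LinearMap.comp_assoc, LinearMap.comp_assoc]
  simp only [LinearMap.comp_assoc]
  conv_lhs => rw [hdh]
  exact hzg' _

variable [Fintype (geo9K i).Site] {Rr : ℝ} {Hp : Prop}

set_option maxHeartbeats 1600000 in
/-- ★★ **`hP3 ⟹ hT3`**: the (3.49)₄ entry of the located `C`-difference word, `conj b((D_U·(M_χ·G′_□ΣG′_□·M_χ)·D*_U)^ℝ) ≺ ε₃·ℓ(a)⁻²·e^{−ρd}`, gives F3-B's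
cut-off form `conj b((M_ζ·D_U·G′_□ΣG′_□·D*_U·M_h)^ℝ) ≺ ε₃·ℓ(a)⁻²·e^{−ρd}` for ANY `ζ, h` with `|ζ♭|, |h♭| ≤ 1` whose gradient stencils lie in the plateau `{χ = 1}`.
[cite: Balaban1985BackgroundPropagators, (3.49) p.399, (3.105) p.414, p.415 l.29–37; Balaban1984PropagatorsII, (2.51) p.232] -/
theorem hasMajorant_cDiffWord_located_of_entry (ιB : BlkY i → IBondY i) (U : CfgY 𝔸 i) (χ ζ h : SiteY i → ℝ)
    (T : (SiteY i → 𝔸) →ₗ[ℂ] (SiteY i → 𝔸))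
    (hζ1 : ∀ f : FBondY i, |hBdY i ζ f| ≤ 1) (hh1 : ∀ f : FBondY i, |hBdY i h f| ≤ 1)
    (hζχ : ∀ (f : FBondY i) (z : SiteY i), hBdY i ζ f ≠ 0 → gradK i f z ≠ 0 → χ z = 1)
    (hhχ : ∀ (f : FBondY i) (z : SiteY i), hBdY i h f ≠ 0 → gradK i f z ≠ 0 → χ z = 1)
    {K : IBondY i → IBondY i → ℝ}
    (hP3 : HasMajorant (g := toB6 (geo9K i) Rr Hp) (fun p : FBondY i × ι => ιB (blkV1 i.hN i.D p.1))
      (conj b ((gradY i U ∘ₗ (cutMulY (𝔸 := 𝔸) χ ∘ₗ T ∘ₗ cutMulY (𝔸 := 𝔸) χ) ∘ₗ divY i U).restrictScalars ℝ)) K) :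
    HasMajorant (g := toB6 (geo9K i) Rr Hp) (fun p : FBondY i × ι => ιB (blkV1 i.hN i.D p.1))
      (conj b ((cutMulY (𝔸 := 𝔸) (hBdY i ζ) ∘ₗ (gradY i U ∘ₗ T ∘ₗ divY i U) ∘ₗ cutMulY (𝔸 := 𝔸) (hBdY i h)).restrictScalars ℝ)) K := by
  classical
  rw [located_word_eq₁ _ _ _ _ (cutMulY (𝔸 := 𝔸) χ) T (cutMulY_comp_gradY_eq_of_plateau i (hBdY i ζ) χ U hζχ)
    (divY_comp_cutMulY_eq_of_plateau i (hBdY i h) χ U hhχ)]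
  set W : (FBondY i → 𝔸) →ₗ[ℂ] (FBondY i → 𝔸) := gradY i U ∘ₗ (cutMulY (𝔸 := 𝔸) χ ∘ₗ T ∘ₗ cutMulY (𝔸 := 𝔸) χ) ∘ₗ divY i U with hW_def
  have e : ((cutMulY (𝔸 := 𝔸) (hBdY i ζ) ∘ₗ W ∘ₗ cutMulY (𝔸 := 𝔸) (hBdY i h)).restrictScalars ℝ : Module.End ℝ (FBondY i → 𝔸)) =
      (cutMulY (𝔸 := 𝔸) (hBdY i ζ)).restrictScalars ℝ * W.restrictScalars ℝ * (cutMulY (𝔸 := 𝔸) (hBdY i h)).restrictScalars ℝ :=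
    LinearMap.ext fun _ => rfl
  rw [e, B9Eq352DivFormLetters.conj_mul, B9Eq352DivFormLetters.conj_mul, conj_cutMulY, conj_cutMulY]
  have hA := hasMajorant_mul_mulOp_right (g := geo9K i) (R := Rr) (H := Hp) (fun p : FBondY i × ι => ιB (blkV1 i.hN i.D p.1))
    (hasMajorant_mulOp_left (G := toB6 (geo9K i) Rr Hp) (fun p : FBondY i × ι => ιB (blkV1 i.hN i.D p.1)) hP3
      (fun p : FBondY i × ι => hBdY i ζ p.1) fun p => hζ1 p.1)
    (fun p : FBondY i × ι => hBdY i h p.1) (fun p => hh1 p.1) Finset.univ (fun p _ => Finset.mem_univ _)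
  refine hasMajorant_mono (g := toB6 (geo9K i) Rr Hp) _ hA fun a y => le_of_eq ?_
  rw [if_pos (Finset.mem_univ _), one_mul]

end CDiff

/-! ## §3  The `hrest` family-3 summand at the located letters -/

section AtLetters

variable [Fintype (geo9K i).Site] [DecidableEq (geo9K i).Site] {Rr : ℝ} {Hp : Prop}
variable {B : B9.Backgrounds} (cfg : B.Cfg → CfgY 𝔸 i) (Gp : SiteOpY 𝔸 i) (parS : SiteParY 𝔸 i) (par : BondParY 𝔸 i) {U₁ : B.Cfg}

set_option maxHeartbeats 6400000 in
/-- ★★★ **FAMILY 3 OF (3.105), THE `hrest` SUMMAND, AT THE LOCATED LETTERS** — for a gauge-law `parS`, gauges `u_□`, fields `Ṽ_□` with the site agreement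
`UboxY (U₁^{u_□}) = UboxY Ṽ_□` on `NearC 2S_j` (the (3.35) window), ANY per-cube plateau cut-offs `χ_□` equal to `1` on the gradient stencils of `supp ζ_□̃♭`,
`supp h_□♭` (the record's `chiY i □`: `B9Eq3105FamThreeCore` §2; a smaller bump is allowed, for a later supplier of `hDL`∕`hDR`), the ζ of record and
`Pl □ = locProjBY i □ parS (u □) (Ṽ □)`:
`Σ_□ conj b((M_{ζ_□̃}·(DPDsY parS G′ U₁ − Pl □)·(M_{h_□}·Oc □ U₁·M_{h_□}))^ℝ) ≺ 3·5^{d+1}·((κ_F3(ε_D) + ε₃)·(M₂Σ‖b_j‖B₀)·Λ′·c₁(δ, 1 − ρ′))·e^{−ρ′δ·d(a,b′)}` over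
`(toB6 (geo9K i) Rr Hp, ιB∘blkV1)`, MODULO: the located `G′`-difference entries `hDL □`∕`hDR □` at `χ_□` (constant `ε_D`), the (3.49)₄ entry `hP3 □` of the located
`C`-difference word (constant `ε₃`), `hE`, `hEO`, `hCinv`, bi-contractive `parS`, `η = |c_f|⁻¹`, the member (2.61) at `(δ₀, β)` and `(δ, 1 − ρ′)`, the transfers.
[cite: Balaban1985BackgroundPropagators, (3.105) p.414, p.415 l.29–37, p.412 l.22–36, p.399 l.19–24, Cor. 3.6 p.408, (3.33)–(3.34) p.396, (3.49) p.399, (3.87) p.409, (3.91) p.410; Balaban1983RegularityDecay, (1.11)–(1.12); Balaban1984PropagatorsII, (2.51)–(2.55) p.232, Lemma 2.1 (2.60)–(2.61) p.234] -/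
theorem hasMajorant_sum_famThree_at_locLetters (hS : IsGaugeLawS i parS)
    {BG δG : ℝ} (hE : EBlock (kernelFamilySInv i B cfg Gp parS) BG δG U₁) (hBG : 0 ≤ BG)
    (Oc : ↥(cubes i.D.toDomains) → BondOpY 𝔸 i) {B₀ δ : ℝ} (hB₀ : 0 ≤ B₀) (hδ : 0 < δ)
    (hEO : ∀ c : ↥(cubes i.D.toDomains), EBlock (kernelFamilyBInv i B cfg (Oc c) par) B₀ δ U₁)
    (ιB : BlkY i → IBondY i) (hι : ∀ s, β i.hN i.D i.hk (ιB s) = s)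
    (hpar : ∀ z w : SiteY i, ‖(parS (cfg U₁) z w : 𝔸)‖ ≤ 1 ∧ ‖(((parS (cfg U₁) z w)⁻¹ : 𝔸ˣ) : 𝔸)‖ ≤ 1)
    {M₂ : ℝ} (hM₂ : 0 ≤ M₂) (hrepr : ∀ (v : 𝔸) (j : ι), |b.repr v j| ≤ M₂ * ‖v‖) (hη : etaS i = |i.cf|⁻¹)
    {s B₁ δX : ℝ} (hs : (etaS i ^ 2 * etaS i ^ 2) * s = 1) (hB₁ : 0 ≤ B₁)
    (hCinv : HasMajorant (g := toB6 (geo9K i) Rr Hp) (fun q : BlkY i × ι => ιB q.1) (conj b (s • (XinvY i parS Gp (cfg U₁)).restrictScalars ℝ))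
      (fun a a' => B₁ * ((geo9K i).len a ^ 4)⁻¹ * Real.exp (-(δX * (geo9K i).dist a a'))))
    (u : ↥(cubes i.D.toDomains) → GaugeY 𝔸 i) (V : ↥(cubes i.D.toDomains) → CfgY 𝔸 i)
    (hagree : ∀ (c : ↥(cubes i.D.toDomains)) (w : SiteY i), NearC i c (2 * SC i c) w.1 → ∀ κ : Fin (d + 1),
      UboxY i (gaugeY i (u c) (cfg U₁)) κ w = UboxY i (V c) κ w)
    (χ : ↥(cubes i.D.toDomains) → SiteY i → ℝ)
    (hζχ : ∀ (c : ↥(cubes i.D.toDomains)) (f : FBondY i) (z : SiteY i), hBdY i (zetaY i c) f ≠ 0 → gradK i f z ≠ 0 → χ c z = 1)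
    (hhχ : ∀ (c : ↥(cubes i.D.toDomains)) (f : FBondY i) (z : SiteY i), hBdY i (hTY i c) f ≠ 0 → gradK i f z ≠ 0 → χ c z = 1)
    {εD δD : ℝ} (hεD : 0 ≤ εD)
    (hDL : ∀ (c : ↥(cubes i.D.toDomains)) (μ : Fin (d + 1)), HasMajorant (g := toB6 (geo9K i) Rr Hp) (fun p : SiteY i × ι => ιB (blkOf i.D.toDomains p.1))
      (conj b (diffLetter (shiftY i) (UboxY i (cfg U₁)) (((etaS i : ℝ) : ℂ))⁻¹ (Sum.inl μ)) *
        conj b ((etaS i ^ 2) • (cutMulY (𝔸 := 𝔸) (χ c) ∘ₗ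
          (Gp (cfg U₁) - GpCubeY i c parS (gaugeY i (u c)⁻¹ (V c)))).restrictScalars ℝ))
      (fun a a' => εD * (geo9K i).len a * Real.exp (-(δD * (geo9K i).dist a a'))))
    (hDR : ∀ (c : ↥(cubes i.D.toDomains)) (ν : Fin (d + 1)), HasMajorant (g := toB6 (geo9K i) Rr Hp) (fun p : SiteY i × ι => ιB (blkOf i.D.toDomains p.1))
      (conj b ((etaS i ^ 2) • ((Gp (cfg U₁) - GpCubeY i c parS (gaugeY i (u c)⁻¹ (V c))) ∘ₗ
          cutMulY (𝔸 := 𝔸) (χ c)).restrictScalars ℝ) *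
        conj b (diffLetter (shiftY i) (UboxY i (cfg U₁)) (((etaS i : ℝ) : ℂ))⁻¹ (Sum.inr ν)))
      (fun a a' => εD * (geo9K i).len a * Real.exp (-(δD * (geo9K i).dist a a'))))
    (dB : ℕ) {δ₀ δP α β' ρ Λ : ℝ} (hΛ : 1 ≤ Λ) (hρ : 0 ≤ ρ) (hα : 0 ≤ α) (hβ : 0 ≤ β') (hδ₀ : 0 ≤ δ₀)
    (hδG' : δP ≤ δG) (hδX' : δP ≤ δX) (hδD' : δP ≤ δD) (hr : ρ + (2 * α + β') * δ₀ ≤ δP)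
    (h261 : Ineq261 dB (toB6 (geo9K i) Rr Hp) δ₀ β')
    (hT1 : ScaleTransfer (geo9K i) δ₀ α Λ (fun a => (geo9K i).len a)) (hT4 : ScaleTransfer (geo9K i) δ₀ α Λ (fun a => ((geo9K i).len a ^ 4)⁻¹))
    {ε₃ : ℝ} (hε₃ : 0 ≤ ε₃)
    (hP3 : ∀ c : ↥(cubes i.D.toDomains), HasMajorant (g := toB6 (geo9K i) Rr Hp) (fun p : FBondY i × ι => ιB (blkV1 i.hN i.D p.1))
      (conj b ((gradY i (cfg U₁) ∘ₗ (cutMulY (𝔸 := 𝔸) (χ c) ∘ₗ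
        (GpCubeY i c parS (gaugeY i (u c)⁻¹ (V c)) ∘ₗ ((QpsY i parS (cfg U₁) ∘ₗ XinvY i parS Gp (cfg U₁) ∘ₗ QpY i parS (cfg U₁))
            - (QpsCubeY i c parS (gaugeY i (u c)⁻¹ (V c)) ∘ₗ XinvCubeY i c parS (gaugeY i (u c)⁻¹ (V c)) ∘ₗ
                QpCubeY i c parS (gaugeY i (u c)⁻¹ (V c)))) ∘ₗ GpCubeY i c parS (gaugeY i (u c)⁻¹ (V c))) ∘ₗ
        cutMulY (𝔸 := 𝔸) (χ c)) ∘ₗ divY i (cfg U₁)).restrictScalars ℝ))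
      (fun a y => ε₃ * ((geo9K i).len a ^ 2)⁻¹ * Real.exp (-(ρ * (geo9K i).dist a y))))
    (dB' : ℕ) {αst ρ' Λ' : ℝ} (hΛ' : 0 ≤ Λ') (hρ' : 0 ≤ ρ') (hsplit : αst + ρ' ≤ ρ / δ)
    (h261' : Ineq261 dB' (toB6 (geo9K i) Rr Hp) δ (1 - ρ')) (hST : ScaleTransfer (geo9K i) δ αst Λ' (fun a => (geo9K i).len a ^ 2)) :
    HasMajorant (g := toB6 (geo9K i) Rr Hp) (fun p : FBondY i × ι => ιB (blkV1 i.hN i.D p.1))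
      (∑ c : ↥(cubes i.D.toDomains), conj b ((cutMulY (𝔸 := 𝔸) (hBdY i (zetaY i c)) *
        (DPDsY i parS Gp (cfg U₁) - locProjBY i c parS (u c) (V c)) *
        (cutMulY (𝔸 := 𝔸) (hBdY i (hTY i c)) * Oc c (cfg U₁) * cutMulY (𝔸 := 𝔸) (hBdY i (hTY i c)))).restrictScalars ℝ))
      (fun a b' => (3 * 5 ^ (d + 1)) *
        ((((M₂ * ∑ j, ‖b j‖) * (M₂ * ∑ j, ‖b j‖) * B₁ * Λ ^ 4 * B6.c1 dB δ₀ β' ^ 2 *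
              (((d : ℝ) + 1) * εD * (2 * (M₂ * (∑ j, ‖b j‖) * BG) + εD)) + ε₃) *
            (M₂ * (∑ j, ‖b j‖) * B₀) * Λ' * B6.c1 dB' δ (1 - ρ')) * Real.exp (-(ρ' * δ * (geo9K i).dist a b')))) := by
  have hSb : 0 ≤ ∑ j, ‖b j‖ := Finset.sum_nonneg fun _ _ => norm_nonneg _
  have hKX : 0 ≤ (M₂ * ∑ j, ‖b j‖) * (M₂ * ∑ j, ‖b j‖) * B₁ * Λ ^ 4 * B6.c1 dB δ₀ β' ^ 2 *
      (((d : ℝ) + 1) * εD * (2 * (M₂ * (∑ j, ‖b j‖) * BG) + εD)) + ε₃ := by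
    have : 0 ≤ M₂ * ∑ j, ‖b j‖ := mul_nonneg hM₂ hSb
    positivity
  -- the transported cube projection IS the cube projection at the gauged-back field
  have hPl : ∀ c : ↥(cubes i.D.toDomains), locProjBY i c parS (u c) (V c) = DPDsCubeY i c parS (gaugeY i (u c)⁻¹ (V c)) := fun c =>
    locProjBY_eq_DPDsCubeY i c hS (u c) (V c)
  -- F3-B's per-cube binder, the window discharged, the `C`-difference word from its (3.49)₄ entry
  have hX : ∀ c : ↥(cubes i.D.toDomains), HasMajorant (g := toB6 (geo9K i) Rr Hp) (fun p : FBondY i × ι => ιB (blkV1 i.hN i.D p.1))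
      (conj b ((cutMulY (𝔸 := 𝔸) (hBdY i (zetaY i c)) * (DPDsY i parS Gp (cfg U₁) - locProjBY i c parS (u c) (V c)) *
        cutMulY (𝔸 := 𝔸) (hBdY i (hTY i c))).restrictScalars ℝ))
      (fun a y => ((M₂ * ∑ j, ‖b j‖) * (M₂ * ∑ j, ‖b j‖) * B₁ * Λ ^ 4 * B6.c1 dB δ₀ β' ^ 2 *
          (((d : ℝ) + 1) * εD * (2 * (M₂ * (∑ j, ‖b j‖) * BG) + εD)) + ε₃) *
        ((geo9K i).len a ^ 2)⁻¹ * Real.exp (-(ρ / δ * δ * (geo9K i).dist a y))) := fun c => by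
    rw [hPl c]
    have hζ1 : ∀ f : FBondY i, |hBdY i (zetaY i c) f| ≤ 1 := fun f => abs_hBdY_zetaY_le_one i c f
    have hh1 : ∀ f : FBondY i, |hBdY i (hTY i c) f| ≤ 1 := fun _ =>
      B6Partition118KLevelTorus.abs_hT_le_one i.D (one_le_Mh i) (B9GeoLemma21KLevelV1.one_le_P i) c _
    refine hasMajorant_mono (g := toB6 (geo9K i) Rr Hp) _
      (hasMajorant_famThree_located_of_cDiff i c b cfg Gp parS hE hBG ιB hι hpar hM₂ hrepr hη hs hB₁ hCinv (χ c) (gaugeY i (u c)⁻¹ (V c))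
        hεD (hDL c) (hDR c) (zetaY i c) (hTY i c) hζ1 hh1 (hζχ c) (hhχ c)
        (window_zetaY i c (u c) (cfg U₁) (V c) (hagree c)) (window_hTY i c (u c) (cfg U₁) (V c) (hagree c))
        dB hΛ hρ hα hβ hδ₀ hδG' hδX' hδD' hr h261 hT1 hT4
        (hasMajorant_cDiffWord_located_of_entry i b ιB (cfg U₁) (χ c) (zetaY i c) (hTY i c) _ hζ1 hh1 (hζχ c) (hhχ c) (hP3 c)))
      fun a y => le_of_eq ?_
    rw [div_mul_cancel₀ _ hδ.ne']
  exact hasMajorant_sum_famThree_zetaY_of_eBlock i b cfg par parS Gp Oc hB₀ hδ.le hEO hM₂ hrepr ιB hι Rr Hp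
    (fun c => locProjBY i c parS (u c) (V c)) dB' hKX hΛ' hρ' hsplit h261' hST hX

set_option maxHeartbeats 6400000 in
/-- ★★ **AT THE LOCALISED FIELDS OF THE (3.35) DATUM**: `hasMajorant_sum_famThree_at_locLetters` with `parS := parSymY i` (def-Y's gauge-law transporters),
`Ṽ_□ := locCfgY i □ η (A □)`, `χ_□ := chiY i □` (plateau hypotheses DISCHARGED, `B9Eq3105FamThreeCore` §2), the site agreement DISCHARGED from the datum's
`hQ`, `hgA` (G-F6a) — the `hrest` family-3 summand of
`eBlock_kernelFamilyBInv_GAY_of_localInverseCubes''` at G-F2's located projection letters `Pl □ = locProjBY i □ parSymY (u □) Ṽ_□`, modulo `hDL`∕`hDR`∕`hP3` and the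
letters' blocks.
[cite: Balaban1985BackgroundPropagators, (3.105) p.414, p.415 l.29–37, Cor. 3.6 p.408 («U′ = U^u = e^{iηA}»), p.409 l.1–3, (3.49) p.399, (3.87) p.409; Balaban1983RegularityDecay, (1.11)–(1.12); Balaban1984PropagatorsII, (2.51)–(2.55) p.232, Lemma 2.1 (2.61) p.234] -/
theorem hasMajorant_sum_famThree_at_locCfg
    {BG δG : ℝ} (hE : EBlock (kernelFamilySInv i B cfg Gp (parSymY i)) BG δG U₁) (hBG : 0 ≤ BG)
    (Oc : ↥(cubes i.D.toDomains) → BondOpY 𝔸 i) {B₀ δ : ℝ} (hB₀ : 0 ≤ B₀) (hδ : 0 < δ)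
    (hEO : ∀ c : ↥(cubes i.D.toDomains), EBlock (kernelFamilyBInv i B cfg (Oc c) par) B₀ δ U₁)
    (ιB : BlkY i → IBondY i) (hι : ∀ s, β i.hN i.D i.hk (ιB s) = s)
    (hpar : ∀ z w : SiteY i, ‖(parSymY i (cfg U₁) z w : 𝔸)‖ ≤ 1 ∧ ‖(((parSymY i (cfg U₁) z w)⁻¹ : 𝔸ˣ) : 𝔸)‖ ≤ 1)
    {M₂ : ℝ} (hM₂ : 0 ≤ M₂) (hrepr : ∀ (v : 𝔸) (j : ι), |b.repr v j| ≤ M₂ * ‖v‖) (hη : etaS i = |i.cf|⁻¹)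
    {s B₁ δX : ℝ} (hs : (etaS i ^ 2 * etaS i ^ 2) * s = 1) (hB₁ : 0 ≤ B₁)
    (hCinv : HasMajorant (g := toB6 (geo9K i) Rr Hp) (fun q : BlkY i × ι => ιB q.1) (conj b (s • (XinvY i (parSymY i) Gp (cfg U₁)).restrictScalars ℝ))
      (fun a a' => B₁ * ((geo9K i).len a ^ 4)⁻¹ * Real.exp (-(δX * (geo9K i).dist a a'))))
    (u : ↥(cubes i.D.toDomains) → GaugeY 𝔸 i) (A : ↥(cubes i.D.toDomains) → AfldY 𝔸 i)
    (Q : ↥(cubes i.D.toDomains) → Set (Site (PV d ℓ i.m i.K hd hL) 0)) (η : ℝ)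
    (hQ : ∀ (c : ↥(cubes i.D.toDomains)) (x : Site (PV d ℓ i.m i.K hd hL) 0), NearC i c (35 * SC i c / 8 + 1) (boxEquiv i.hN x).1 → x ∈ Q c)
    (hgA : ∀ (c : ↥(cubes i.D.toDomains)) (κ : Fin (d + 1)) (x : Site (PV d ℓ i.m i.K hd hL) 0), x ∈ Q c → x.shift κ ∈ Q c →
      gaugeY i (u c) (cfg U₁) κ x = fluct η (A c) κ x)
    {εD δD : ℝ} (hεD : 0 ≤ εD)
    (hDL : ∀ (c : ↥(cubes i.D.toDomains)) (μ : Fin (d + 1)), HasMajorant (g := toB6 (geo9K i) Rr Hp) (fun p : SiteY i × ι => ιB (blkOf i.D.toDomains p.1))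
      (conj b (diffLetter (shiftY i) (UboxY i (cfg U₁)) (((etaS i : ℝ) : ℂ))⁻¹ (Sum.inl μ)) *
        conj b ((etaS i ^ 2) • (cutMulY (𝔸 := 𝔸) (B9Cor36CubeCutoffs.chiY i c) ∘ₗ
          (Gp (cfg U₁) - GpCubeY i c (parSymY i) (gaugeY i (u c)⁻¹ (locCfgY i c η (A c))))).restrictScalars ℝ))
      (fun a a' => εD * (geo9K i).len a * Real.exp (-(δD * (geo9K i).dist a a'))))
    (hDR : ∀ (c : ↥(cubes i.D.toDomains)) (ν : Fin (d + 1)), HasMajorant (g := toB6 (geo9K i) Rr Hp) (fun p : SiteY i × ι => ιB (blkOf i.D.toDomains p.1))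
      (conj b ((etaS i ^ 2) • ((Gp (cfg U₁) - GpCubeY i c (parSymY i) (gaugeY i (u c)⁻¹ (locCfgY i c η (A c)))) ∘ₗ
          cutMulY (𝔸 := 𝔸) (B9Cor36CubeCutoffs.chiY i c)).restrictScalars ℝ) *
        conj b (diffLetter (shiftY i) (UboxY i (cfg U₁)) (((etaS i : ℝ) : ℂ))⁻¹ (Sum.inr ν)))
      (fun a a' => εD * (geo9K i).len a * Real.exp (-(δD * (geo9K i).dist a a'))))
    (dB : ℕ) {δ₀ δP α β' ρ Λ : ℝ} (hΛ : 1 ≤ Λ) (hρ : 0 ≤ ρ) (hα : 0 ≤ α) (hβ : 0 ≤ β') (hδ₀ : 0 ≤ δ₀)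
    (hδG' : δP ≤ δG) (hδX' : δP ≤ δX) (hδD' : δP ≤ δD) (hr : ρ + (2 * α + β') * δ₀ ≤ δP)
    (h261 : Ineq261 dB (toB6 (geo9K i) Rr Hp) δ₀ β')
    (hT1 : ScaleTransfer (geo9K i) δ₀ α Λ (fun a => (geo9K i).len a)) (hT4 : ScaleTransfer (geo9K i) δ₀ α Λ (fun a => ((geo9K i).len a ^ 4)⁻¹))
    {ε₃ : ℝ} (hε₃ : 0 ≤ ε₃)
    (hP3 : ∀ c : ↥(cubes i.D.toDomains), HasMajorant (g := toB6 (geo9K i) Rr Hp) (fun p : FBondY i × ι => ιB (blkV1 i.hN i.D p.1))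
      (conj b ((gradY i (cfg U₁) ∘ₗ (cutMulY (𝔸 := 𝔸) (B9Cor36CubeCutoffs.chiY i c) ∘ₗ
        (GpCubeY i c (parSymY i) (gaugeY i (u c)⁻¹ (locCfgY i c η (A c))) ∘ₗ
          ((QpsY i (parSymY i) (cfg U₁) ∘ₗ XinvY i (parSymY i) Gp (cfg U₁) ∘ₗ QpY i (parSymY i) (cfg U₁))
            - (QpsCubeY i c (parSymY i) (gaugeY i (u c)⁻¹ (locCfgY i c η (A c))) ∘ₗ
                XinvCubeY i c (parSymY i) (gaugeY i (u c)⁻¹ (locCfgY i c η (A c))) ∘ₗ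
                QpCubeY i c (parSymY i) (gaugeY i (u c)⁻¹ (locCfgY i c η (A c))))) ∘ₗ
          GpCubeY i c (parSymY i) (gaugeY i (u c)⁻¹ (locCfgY i c η (A c)))) ∘ₗ
        cutMulY (𝔸 := 𝔸) (B9Cor36CubeCutoffs.chiY i c)) ∘ₗ divY i (cfg U₁)).restrictScalars ℝ))
      (fun a y => ε₃ * ((geo9K i).len a ^ 2)⁻¹ * Real.exp (-(ρ * (geo9K i).dist a y))))
    (dB' : ℕ) {αst ρ' Λ' : ℝ} (hΛ' : 0 ≤ Λ') (hρ' : 0 ≤ ρ') (hsplit : αst + ρ' ≤ ρ / δ)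
    (h261' : Ineq261 dB' (toB6 (geo9K i) Rr Hp) δ (1 - ρ')) (hST : ScaleTransfer (geo9K i) δ αst Λ' (fun a => (geo9K i).len a ^ 2)) :
    HasMajorant (g := toB6 (geo9K i) Rr Hp) (fun p : FBondY i × ι => ιB (blkV1 i.hN i.D p.1))
      (∑ c : ↥(cubes i.D.toDomains), conj b ((cutMulY (𝔸 := 𝔸) (hBdY i (zetaY i c)) *
        (DPDsY i (parSymY i) Gp (cfg U₁) - locProjBY i c (parSymY i) (u c) (locCfgY i c η (A c))) *
        (cutMulY (𝔸 := 𝔸) (hBdY i (hTY i c)) * Oc c (cfg U₁) * cutMulY (𝔸 := 𝔸) (hBdY i (hTY i c)))).restrictScalars ℝ))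
      (fun a b' => (3 * 5 ^ (d + 1)) *
        ((((M₂ * ∑ j, ‖b j‖) * (M₂ * ∑ j, ‖b j‖) * B₁ * Λ ^ 4 * B6.c1 dB δ₀ β' ^ 2 *
              (((d : ℝ) + 1) * εD * (2 * (M₂ * (∑ j, ‖b j‖) * BG) + εD)) + ε₃) *
            (M₂ * (∑ j, ‖b j‖) * B₀) * Λ' * B6.c1 dB' δ (1 - ρ')) * Real.exp (-(ρ' * δ * (geo9K i).dist a b')))) :=
  hasMajorant_sum_famThree_at_locLetters i b cfg Gp (parSymY i) par (parSymY_isGaugeLawS i) hE hBG Oc hB₀ hδ hEO ιB hι hpar hM₂ hrepr hη hs hB₁ hCinv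
    u (fun c => locCfgY i c η (A c)) (fun c w hw κ => agree_of_datum i c (u c) (cfg U₁) (A c) (Q c) η (hQ c) (hgA c) w hw κ)
    (fun c => B9Cor36CubeCutoffs.chiY i c) (fun c _ _ hf hz => chiY_eq_one_of_zetaY_gradK i c hf hz) (fun c _ _ hf hz => chiY_eq_one_of_hTY_gradK i c hf hz)
    hεD hDL hDR dB hΛ hρ hα hβ hδ₀ hδG' hδX' hδD' hr h261 hT1 hT4 hε₃ hP3 dB' hΛ' hρ' hsplit h261' hST

end AtLetters

end Literature.MathematicalPhysics.QuantumFieldTheory.Balaban1983to89.B9Eq3105FamThreeAtLocCfg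

end
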